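import Literature.Topology.FourManifolds.MMSWRasmussenGeneralPosition

/-!
# Helper `helper_handlebodyChart_modelHandles` (M3: handle structure of the model dotted handlebody `D_k`)
# of line `mk_friends` for crux `DcrGap` — inflation of the holes, part 1: the radial derivative
(item stmt-SmoothPoincare4-16128, route route-SmoothPoincare4-DottedCircleRasmussen)

**Registered piece `helper_handlebodyChart_modelHandles_inflateAux` of the model lemma M3.**  Third stage
of the squeeze of part 2 of the data stub `helper_handlebodyChart_modelHandles_data` is the **inflation of
the holes**: the flow of an outward radial field `b (z - c_j, 0)` about each hole centre `c_j`, cut off to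
`{G_k < 97/100}` (so that it is supported in `D_k`), carrying `D_k ∩ {G_k ≤ 24/25}` into
`{|z - c_j|² ≥ 11/4}` (beyond the stall layers `8/5 ≤ |z - c_j| ≤ 41/25` of the final radial flow).  For the
cutoff to stay equal to `1` along the orbits one needs `G_k` to be non-increasing along outward rays from
`c_j` as long as `|z - c_j| ≤ 42/25`, i.e. the sign of the radial derivative of the planar potential
`g_k = |z|²/R² + Σ_m |z - c_m|⁻²` (`R = 40(k+1)`): with the complex half-gradient
`∇ = z/R² - Σ_m (z - c_m)/|z - c_m|⁴` one has `2 Re(∇ · \overline{(z - c_j)}) = d/dt g_k(c_j + e^t (z - c_j))`,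
and this file proves `Re(∇ · \overline{(z - c_j)}) < 0` for `0 < |z - c_j| ≤ 42/25`
(`ModelHandles.re_gradC_mul_conj_neg`): the own hole contributes `-1/ρ²` (`ρ = |z - c_j|`), the
confinement at most `ρ |z|/R² ≤ ρ/800`, and the other holes, at horizontal distances `≥ 4|m - j| - 42/25`,
at most `ρ · 2 Σ_{n ≥ 0} (4n + 58/25)⁻³ ≤ ρ (2 (25/58)³ + 1/48)` (lattice folding `MMSW.sum_fin_le_fold` and a
telescoping tail, as in the regular-value analysis `MMSW.gradC_ne_zero_of_near`); and
`(42/25)³ (1/800 + 2 (25/58)³ + 1/48) < 1`.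

No definitions, no named facts, no `sorry`.  References: J. Milnor, *Morse Theory* (1963), §3
[Milnor1963].
-/

-- the prescribed namespace `Summit.<P>.<Sub>.…` duplicates `SmoothPoincare4` (P = Sub)
set_option linter.dupNamespace false
set_option linter.style.longLine false

noncomputable section

open scoped Topology ComplexConjugate
open Function Set
open Literature.Topology.FourManifolds Literature.Topology.FourManifolds.MMSW

namespace Summit.SmoothPoincare4.SmoothPoincare4.Theorems.DcrGap.MkFriends

namespace ModelHandles

variable {r : ℕ}

/-- Horizontal spacing of the holes seen from a point within `42/25` of the hole `j₁`: the `j`-th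
centre is at horizontal distance `≥ 4|j - j₁| - 42/25` from the point. [folklore] -/
theorem abs_re_sub_holeCentre_ge' (Z : ℂ) (j₁ j : Fin r) (hd : ‖Z - holeCentre r j₁‖ ≤ 42 / 25) :
    4 * |(((j : ℤ) + 1 - ((j₁ : ℤ) + 1) : ℤ) : ℝ)| - 42 / 25 ≤ |(Z - holeCentre r j).re| := by
  have h1 : |(Z - holeCentre r j₁).re| ≤ 42 / 25 := (Complex.abs_re_le_norm _).trans hd
  simp only [Complex.sub_re, holeCentre_re] at h1 ⊢
  have hcast : (((j : ℤ) + 1 - ((j₁ : ℤ) + 1) : ℤ) : ℝ) = ((j : ℕ) : ℝ) - ((j₁ : ℕ) : ℝ) := by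
    push_cast; ring
  rw [hcast]
  have htri : |4 * (((j : ℕ) : ℝ) - ((j₁ : ℕ) : ℝ))| ≤
      |Z.re - 4 * (((j₁ : ℕ) : ℝ) + 1)| + |Z.re - 4 * (((j : ℕ) : ℝ) + 1)| := by
    have := abs_sub_le (Z.re - 4 * (((j₁ : ℕ) : ℝ) + 1)) 0 (Z.re - 4 * (((j : ℕ) : ℝ) + 1))
    have e : Z.re - 4 * (((j₁ : ℕ) : ℝ) + 1) - (Z.re - 4 * (((j : ℕ) : ℝ) + 1)) =
        4 * (((j : ℕ) : ℝ) - ((j₁ : ℕ) : ℝ)) := by ring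
    rw [e, sub_zero, zero_sub, abs_neg] at this
    exact this
  rw [abs_mul, abs_of_pos (by norm_num : (0 : ℝ) < 4)] at htri
  linarith

/-- The tail of the inverse-cube series over the other holes:
`∑_{n<N} (4n + 58/25)⁻³ ≤ (25/58)³ + 1/96`. [folklore] -/
theorem sum_inv_cube_le' (N : ℕ) :
    ∑ n ∈ Finset.range N, ((4 * (n : ℝ) + 58 / 25) ^ 3)⁻¹ ≤ ((58 / 25 : ℝ) ^ 3)⁻¹ + 1 / 96 := by
  have hnn : ∀ n : ℕ, 0 ≤ ((4 * (n : ℝ) + 58 / 25) ^ 3)⁻¹ := fun n ↦ by positivity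
  have h1 : ∑ n ∈ Finset.range N, ((4 * (n : ℝ) + 58 / 25) ^ 3)⁻¹ ≤
      ∑ n ∈ Finset.range (N + 1), ((4 * (n : ℝ) + 58 / 25) ^ 3)⁻¹ :=
    Finset.sum_le_sum_of_subset_of_nonneg (Finset.range_subset_range.2 (Nat.le_succ N)) fun n _ _ ↦
        hnn n
  refine h1.trans ?_
  rw [Finset.sum_range_succ']
  simp only [Nat.cast_add, Nat.cast_one, CharP.cast_eq_zero, mul_zero, zero_add]
  rw [add_comm]
  gcongr
  -- telescoping majorant `u n = (1/96)/(n+1)`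
  have hle : ∀ n : ℕ, ((4 * ((n : ℝ) + 1) + 58 / 25) ^ 3)⁻¹ ≤
      (1 / 96) / ((n : ℝ) + 1) - (1 / 96) / ((n : ℝ) + 1 + 1) := fun n ↦ by
    have hn : (0 : ℝ) ≤ n := Nat.cast_nonneg n
    rw [div_sub_div _ _ (by positivity) (by positivity), ← one_div, div_le_div_iff₀ (by positivity)
                                                                                          (by positivity)]
    nlinarith [sq_nonneg ((n : ℝ) + 1), mul_nonneg hn (sq_nonneg (n : ℝ)), mul_nonneg hn hn]
  refine (Finset.sum_le_sum fun n _ ↦ hle n).trans ?_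
  have := sum_range_sub_le (fun n : ℕ ↦ (1 / 96) / ((n : ℝ) + 1)) (fun n ↦ by positivity) N
  simp only [Nat.cast_add, Nat.cast_one] at this
  simpa using this

/-- **The pull of the other holes near the hole `j₁`**: for `‖z - c_{j₁}‖ ≤ 42/25` the gradient terms of
the holes `m ≠ j₁` sum to at most `2 (25/58)³ + 1/48` in norm (lattice folding about `j₁`). [folklore] -/
theorem norm_sum_erase_holeGradTerm_le (Z : ℂ) (j₁ : Fin r) (hd : ‖Z - holeCentre r j₁‖ ≤ 42 / 25) :
    ‖∑ j ∈ Finset.univ.erase j₁, ((Complex.normSq (Z - holeCentre r j)) ^ 2)⁻¹ • (Z - holeCentre r j)‖ ≤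
      2 * ((58 / 25 : ℝ) ^ 3)⁻¹ + 1 / 48 := by
  classical
  set t : Fin r → ℂ := fun j ↦ ((Complex.normSq (Z - holeCentre r j)) ^ 2)⁻¹ • (Z - holeCentre r j)
    with ht
  -- the folded majorant, vanishing at offset `0`
  set β : ℤ → ℝ := fun m ↦ if m = 0 then 0 else ((max (4 * |(m : ℝ)| - 42 / 25) (58 / 25)) ^ 3)⁻¹
    with hβ
  have hβnn : ∀ m, 0 ≤ β m := fun m ↦ by
    simp only [hβ]; split_ifs
    · exact le_rfl
    · positivity
  have hterm : ∀ j ∈ Finset.univ.erase j₁, ‖t j‖ ≤ β ((j : ℤ) + 1 - ((j₁ : ℤ) + 1)) := by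
    intro j hj
    have hne : j ≠ j₁ := Finset.ne_of_mem_erase hj
    have hsp := abs_re_sub_holeCentre_ge' Z j₁ j hd
    have hm0 : ((j : ℤ) + 1 - ((j₁ : ℤ) + 1)) ≠ 0 := by
      intro h; apply hne; exact Fin.ext (by omega)
    have hm1 : (1 : ℝ) ≤ |(((j : ℤ) + 1 - ((j₁ : ℤ) + 1) : ℤ) : ℝ)| := by
      rw [← Int.cast_abs]
      have : (1 : ℤ) ≤ |((j : ℤ) + 1 - ((j₁ : ℤ) + 1))| := Int.one_le_abs hm0
      exact_mod_cast this
    have hmax : max (4 * |(((j : ℤ) + 1 - ((j₁ : ℤ) + 1) : ℤ) : ℝ)| - 42 / 25) (58 / 25) =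
        4 * |(((j : ℤ) + 1 - ((j₁ : ℤ) + 1) : ℤ) : ℝ)| - 42 / 25 := max_eq_left (by linarith)
    simp only [ht, hβ, if_neg hm0, hmax]
    exact norm_holeGradTerm_le (by linarith) (hsp.trans (Complex.abs_re_le_norm _))
  refine (norm_sum_le _ _).trans ((Finset.sum_le_sum hterm).trans ?_)
  refine (Finset.sum_le_sum_of_subset_of_nonneg (Finset.erase_subset j₁ Finset.univ)
    (fun j _ _ ↦ hβnn _)).trans ?_
  refine (sum_fin_le_fold β hβnn ((j₁ : ℤ) + 1) r).trans ?_
  have hβ0 : β 0 = 0 := by simp [hβ]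
  have hβn : ∀ n : ℕ, β ((n : ℤ) + 1) + β (-((n : ℤ) + 1)) = 2 * ((4 * (n : ℝ) + 58 / 25) ^ 3)⁻¹ := by
    intro n
    have hn : (0 : ℝ) ≤ n := Nat.cast_nonneg n
    have hz1 : ((n : ℤ) + 1) ≠ 0 := by omega
    have hz2 : (-((n : ℤ) + 1)) ≠ 0 := by omega
    have e1 : |(((n : ℤ) + 1 : ℤ) : ℝ)| = (n : ℝ) + 1 := by
      push_cast; exact abs_of_nonneg (by positivity)
    have e2 : |((-((n : ℤ) + 1) : ℤ) : ℝ)| = (n : ℝ) + 1 := by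
      push_cast; rw [abs_neg]; exact abs_of_nonneg (by positivity)
    simp only [hβ, if_neg hz1, if_neg hz2, e1, e2]
    rw [max_eq_left (by linarith)]
    ring
  rw [hβ0, Finset.sum_congr rfl fun n _ ↦ hβn n, ← Finset.mul_sum, zero_add]
  have := sum_inv_cube_le' (r + 1 + ((j₁ : ℤ) + 1).natAbs)
  linarith

/-- **The planar potential decreases along outward rays near a hole.**  For `0 < |z - c_j| ≤ 42/25`
the complex half-gradient `∇ = z/R² - Σ_m (z - c_m)/|z - c_m|⁴` of `g_k` (`R = 40(k+1)`) satisfies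
`Re(∇ · \overline{(z - c_j)}) < 0`: the own hole gives `-1/ρ²` (`ρ = |z - c_j|`), the confinement at most
`ρ/800`, the other holes at most `ρ (2 (25/58)³ + 1/48)`, and `ρ³ (1/800 + 2 (25/58)³ + 1/48) < 1`. [folklore] -/
theorem re_gradC_mul_conj_neg (Z : ℂ) (j₁ : Fin r) (h0 : Z ≠ holeCentre r j₁)
    (hd : ‖Z - holeCentre r j₁‖ ≤ 42 / 25) :
    ((((40 * ((r : ℝ) + 1)) ^ 2)⁻¹ • Z -
      ∑ j : Fin r, ((Complex.normSq (Z - holeCentre r j)) ^ 2)⁻¹ • (Z - holeCentre r j)) *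
        conj (Z - holeCentre r j₁)).re < 0 := by
  classical
  set R : ℝ := 40 * ((r : ℝ) + 1) with hR
  set e : ℂ := Z - holeCentre r j₁ with he
  set ρ : ℝ := ‖e‖ with hρ
  set t : Fin r → ℂ := fun j ↦ ((Complex.normSq (Z - holeCentre r j)) ^ 2)⁻¹ • (Z - holeCentre r j)
    with ht
  have hr1 : (1 : ℝ) ≤ r := by exact_mod_cast Nat.succ_le_of_lt (Fin.pos j₁)
  have he0 : e ≠ 0 := sub_ne_zero.2 h0
  have hρ0 : 0 < ρ := norm_pos_iff.2 he0
  have hρ1 : ρ ≤ 42 / 25 := hd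
  -- the own hole: `Re(t j₁ · conj e) = 1/ρ²`
  have hown : (t j₁ * conj e).re = (ρ ^ 2)⁻¹ := by
    have hns : Complex.normSq e = ρ ^ 2 := Complex.normSq_eq_norm_sq e
    have hmul : e * conj e = ((Complex.normSq e : ℝ) : ℂ) := Complex.mul_conj e
    simp only [ht, ← he, Complex.real_smul]
    rw [mul_assoc, hmul, hns]
    have hρ2 : (ρ ^ 2) ≠ 0 := by positivity
    have hc : ((((ρ ^ 2) ^ 2)⁻¹ : ℝ) : ℂ) * (((ρ ^ 2 : ℝ)) : ℂ) = (((ρ ^ 2)⁻¹ : ℝ) : ℂ) := by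
      push_cast; field_simp
    rw [hc]
    exact Complex.ofReal_re _
  -- the confinement term
  have hZle : ‖Z‖ ≤ 4 * ((r : ℝ) + 1) := by
    have h1 : ‖Z‖ ≤ ‖Z - holeCentre r j₁‖ + ‖holeCentre r j₁‖ := norm_le_norm_sub_add Z _
    have h2 := norm_holeCentre_le j₁
    linarith
  have hconf : (((R ^ 2)⁻¹ : ℝ) • Z * conj e).re ≤ ρ / 800 := by
    refine (Complex.re_le_norm _).trans ?_
    rw [norm_mul, Complex.norm_conj, norm_smul, norm_inv, norm_pow, Real.norm_of_nonneg (by positivity),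
      ← hρ]
    have h1 : (R ^ 2)⁻¹ * ‖Z‖ ≤ 1 / 800 := by
      rw [inv_mul_le_iff₀ (by positivity)]
      rw [hR]; nlinarith
    calc (R ^ 2)⁻¹ * ‖Z‖ * ρ ≤ 1 / 800 * ρ := mul_le_mul_of_nonneg_right h1 hρ0.le
      _ = ρ / 800 := by ring
  -- the other holes
  set B : ℝ := 2 * ((58 / 25 : ℝ) ^ 3)⁻¹ + 1 / 48 with hBdef
  have hrest : -(B * ρ) ≤ ((∑ j ∈ Finset.univ.erase j₁, t j) * conj e).re := by
    have h1 := Complex.abs_re_le_norm ((∑ j ∈ Finset.univ.erase j₁, t j) * conj e)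
    have h2 : ‖(∑ j ∈ Finset.univ.erase j₁, t j) * conj e‖ ≤ B * ρ := by
      rw [norm_mul, Complex.norm_conj, ← hρ]
      exact mul_le_mul_of_nonneg_right (norm_sum_erase_holeGradTerm_le Z j₁ hd) hρ0.le
    linarith [neg_abs_le ((∑ j ∈ Finset.univ.erase j₁, t j) * conj e).re]
  -- assemble
  have hsplit : ∑ j : Fin r, t j = t j₁ + ∑ j ∈ Finset.univ.erase j₁, t j :=
    (Finset.add_sum_erase Finset.univ t (Finset.mem_univ j₁)).symm
  have hexp : ((((R ^ 2)⁻¹ : ℝ) • Z - ∑ j : Fin r, t j) * conj e).re =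
      (((R ^ 2)⁻¹ : ℝ) • Z * conj e).re - (t j₁ * conj e).re -
        ((∑ j ∈ Finset.univ.erase j₁, t j) * conj e).re := by
    rw [hsplit, sub_mul, Complex.sub_re, add_mul, Complex.add_re]
    ring
  show ((((R ^ 2)⁻¹ : ℝ) • Z - ∑ j : Fin r, t j) * conj e).re < 0
  rw [hexp, hown]
  -- the numerical inequality `ρ³ (1/800 + B) < 1`
  have hB : (1 : ℝ) / 800 + B ≤ 1823 / 10000 := by rw [hBdef]; norm_num
  have hρ3 : ρ ^ 3 ≤ (42 / 25 : ℝ) ^ 3 := by gcongr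
  have hkey : ρ * (1 / 800 + B) < (ρ ^ 2)⁻¹ := by
    rw [← one_div, lt_div_iff₀ (by positivity)]
    have h1 : ρ * (1 / 800 + B) ≤ ρ * (1823 / 10000) := mul_le_mul_of_nonneg_left hB hρ0.le
    nlinarith
  clear_value ρ B R e t
  linarith [hconf, hrest, hkey]

end ModelHandles

/-- **Registered piece `helper_handlebodyChart_modelHandles_inflateAux` of the model lemma M3 (the planar
potential decreases along outward rays near a hole)**: for `0 < |z - c_j| ≤ 42/25` the complex
half-gradient `∇ = z/R² - Σ_m (z - c_m)/|z - c_m|⁴` of `g_k` satisfies `Re(∇ · \overline{(z - c_j)}) < 0`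
(`ModelHandles.re_gradC_mul_conj_neg`), so that `G_k` is non-increasing along the inflation of the holes.
[folklore] -/
theorem helper_handlebodyChart_modelHandles_inflateAux : ∀ (k : ℕ) (j : Fin k) (Z : ℂ), Z ≠ Literature.Topology.FourManifolds.MMSW.holeCentre k j → ‖Z - Literature.Topology.FourManifolds.MMSW.holeCentre k j‖ ≤ 42 / 25 → ((((40 * ((k : ℝ) + 1)) ^ 2)⁻¹ • Z - ∑ m : Fin k, ((Complex.normSq (Z - Literature.Topology.FourManifolds.MMSW.holeCentre k m)) ^ 2)⁻¹ • (Z - Literature.Topology.FourManifolds.MMSW.holeCentre k m)) * (starRingEnd ℂ) (Z - Literature.Topology.FourManifolds.MMSW.holeCentre k j)).re < 0 :=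
  fun _ j Z h0 hd => ModelHandles.re_gradC_mul_conj_neg Z j h0 hd

end Summit.SmoothPoincare4.SmoothPoincare4.Theorems.DcrGap.MkFriends

end
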